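import Literature.NumberTheory.Automorphic.ArchimedeanApplyFreeCongr
import Literature.NumberTheory.Automorphic.ArchFlowParametricIntegral
import Literature.NumberTheory.Automorphic.CentralOneParameterODE
import Literature.NumberTheory.Automorphic.AutomorphicTwistBJ
import HarnessLib

/-!
# The archimedean calculus under multiplication by a character with a differential:
# `Z(𝔤)`-finiteness of `|det|^s · φ` (Borel–Jacquet's twists `π ⊗ χ` for `χ` not of finite order)

Topic `NumberTheory/Automorphic`. Let `H : RealMatrixGroup A N` be a linear real group
(`𝔤 = H.lie`), `ι : H → G` a homomorphism into a group and `c : G →* ℂˣ` a character whose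
restriction to the one-parameter subgroups of `𝔤` is an exponential,
`c (ι (exp X)) = e^{δ(X)}` for an `ℝ`-linear `δ : 𝔤 → ℂ` (for `G = GL_n(𝔸_K)` and `c = |det|_𝔸^s`:
`δ(X) = s ∑_{w ∣ ∞} [K_w : ℝ] re tr X_w`). The companion file `AutomorphicTwistBJ` treats the
case `δ = 0` (characters of finite order, trivial on `exp 𝔤`), where Lie derivatives commute with
`φ ↦ c · φ` on the nose. Here we prove, for `φ` smooth in the archimedean variable:

* `lieDeriv_mulChar_of_exp` — **`X (c · φ) = c · (X φ + δ(X) φ)`** (Leibniz);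
  `isArchSmooth_mulChar_of_exp`.
* `applyFree_mulChar_eq_envelopingAction` — for a word `p ∈ ℝ⟨𝔤⟩`, **`p (c · φ) = c · (τ_δ p) φ`**,
  where `τ_δ` is the action of `U(𝔤)` on smooth functions through the *twisted* Lie algebra
  homomorphism `X ↦ (ψ ↦ X ψ + δ(X) ψ)` (a Lie algebra homomorphism as soon as `δ` kills brackets,
  `exists_lieHom_add_smul_one`); proved by induction on `p` (`FreeAlgebra.induction`), the product
  step being `(p q) ψ = p (q ψ)` on smooth `ψ` (`applyFree_mul_apply_of_isArchSmooth`).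
* **Real differentials** (`δ = λ` real-valued, `λ([X, Y]) = 0`): the substitution
  `X ↦ X + λ(X)` is an algebra automorphism of `U(𝔤)` preserving the centre, so for a central word
  `p` there is a central word `p'` with `p (c · φ) = c · (p' φ)`
  (`exists_isCentralWord_applyFree_mulChar_eq`), whence **`c · φ` is `Z(𝔤)`-finite if `φ` is**
  (`isZFinite_mulChar_of_exp_real`).
* **Complex multiples of a real differential** (`δ = s λ`, `s ∈ ℂ` — the case of `|det|^{s}`,
  `s ∉ ℝ`, needed to normalise an arbitrary central character to be trivial on `A_G`): the twisted
  action of a fixed word is a *polynomial* in `s` with operator coefficients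
  (`exists_polynomial_envelopingAction_eq`), its values at real `s` lie in the `Z(𝔤)`-orbit span of
  `φ` by the real case, hence so do its coefficients (a Vandermonde argument in the quotient,
  `mem_of_forall_sum_ofReal_pow_smul_mem`) and its value at every complex `s`:
  **`isZFinite_mulChar_of_exp_family`**.

These are the archimedean inputs of Borel–Jacquet 1979, §4.2–4.6 for twists `π ⊗ (χ ∘ det)` by
Hecke characters `χ` that are not of finite order (op. cit. 5.7: "every cuspidal representation is
`π₀ ⊗ |det|^s` with `π₀` unitary"), i.e. Arthur–Clozel's "We may assume `π, π'` unitary"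
(*Simple algebras, base change, …* (1989), Ch. 3, proof of Thm. 3.1). Everything here is proved;
there are no definitions and no named facts.

## References

* A. Borel, H. Jacquet, *Automorphic forms and automorphic representations*, Proc. Sympos. Pure
  Math. 33 (1979), part 1, §1.5–1.6, §4.2, 5.7 [BorelJacquet1979].
* J. Dixmier, *Enveloping Algebras* (1977/1996), 2.1.1, 2.2 (automorphisms of `U(𝔤)`).
* J. Arthur, L. Clozel, *Simple algebras, base change, and the advanced theory of the trace
  formula*, Ann. of Math. Stud. 120 (1989), Ch. 3, proof of Thm. 3.1 [ArthurClozelAMS120].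
-/

-- Mathlib idiom (Mathlib/Algebra/Lie/OfAssociative.lean); needed to mention Lie subalgebras of matrix algebras
attribute [local instance 100] LieRing.ofAssociativeRing

noncomputable section

open scoped MatrixGroups Matrix ContDiff
open Polynomial

namespace Literature.NumberTheory.Automorphic

/-! ### Twisting a Lie algebra representation by a character of the Lie algebra -/

section TwistedLieHom

/-- **Twist of a Lie algebra action by a scalar character.** For a real Lie algebra homomorphism
`ρ : L → End_ℂ V` and an `ℝ`-linear `a : L → ℂ` vanishing on brackets,
`X ↦ ρ X + a(X) · 1` is again a Lie algebra homomorphism (the scalars are central). This is the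
infinitesimal form of twisting a representation by a character; Dixmier 2.2. [folklore] -/
theorem exists_lieHom_add_smul_one {L : Type*} [LieRing L] [LieAlgebra ℝ L] {V : Type*}
    [AddCommGroup V] [Module ℂ V] (ρ : L →ₗ⁅ℝ⁆ Module.End ℂ V) (a : L →ₗ[ℝ] ℂ)
    (ha : ∀ X Y : L, a ⁅X, Y⁆ = 0) :
    ∃ ρ' : L →ₗ⁅ℝ⁆ Module.End ℂ V, ∀ X, ρ' X = ρ X + a X • (1 : Module.End ℂ V) := by
  refine ⟨{ toFun := fun X => ρ X + a X • (1 : Module.End ℂ V)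
            map_add' := fun X Y => by simp only [map_add, add_smul]; abel
            map_smul' := fun r X => by
              simp only [map_smul, RingHom.id_apply, smul_add, smul_assoc]
            map_lie' := fun {X Y} => ?_ }, fun X => rfl⟩
  change ρ ⁅X, Y⁆ + a ⁅X, Y⁆ • (1 : Module.End ℂ V) = ⁅ρ X + a X • 1, ρ Y + a Y • 1⁆
  have h1 : ∀ T : Module.End ℂ V, ⁅T, (1 : Module.End ℂ V)⁆ = 0 := fun T => by
    rw [LieRing.of_associative_ring_bracket, mul_one, one_mul, sub_self]
  have h2 : ∀ T : Module.End ℂ V, ⁅(1 : Module.End ℂ V), T⁆ = 0 := fun T => by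
    rw [LieRing.of_associative_ring_bracket, mul_one, one_mul, sub_self]
  rw [ha, zero_smul, add_zero, LieHom.map_lie]
  simp only [lie_add, add_lie, lie_smul, smul_lie, h1, h2, smul_zero, add_zero]

/-- **Twist by a real character, with values in any algebra.** For a real Lie algebra
homomorphism `f : L → B` into an associative `ℝ`-algebra and an `ℝ`-linear `a : L → ℝ` vanishing
on brackets, `X ↦ f X + a(X) · 1` is a Lie algebra homomorphism. Dixmier 2.2. [folklore] -/
theorem exists_lieHom_add_algebraMap {L : Type*} [LieRing L] [LieAlgebra ℝ L] {B : Type*}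
    [Ring B] [Algebra ℝ B] (f : L →ₗ⁅ℝ⁆ B) (a : L →ₗ[ℝ] ℝ) (ha : ∀ X Y : L, a ⁅X, Y⁆ = 0) :
    ∃ f' : L →ₗ⁅ℝ⁆ B, ∀ X, f' X = f X + algebraMap ℝ B (a X) := by
  refine ⟨{ toFun := fun X => f X + algebraMap ℝ B (a X)
            map_add' := fun X Y => by simp only [map_add]; abel
            map_smul' := fun r X => by
              simp only [map_smul, RingHom.id_apply, smul_add, Algebra.algebraMap_eq_smul_one,
                smul_assoc]
            map_lie' := fun {X Y} => ?_ }, fun X => rfl⟩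
  have h1 : ∀ (r : ℝ) (T : B), ⁅T, algebraMap ℝ B r⁆ = 0 := fun r T => by
    rw [LieRing.of_associative_ring_bracket, ← Algebra.commutes, sub_self]
  have h2 : ∀ (r : ℝ) (T : B), ⁅algebraMap ℝ B r, T⁆ = 0 := fun r T => by
    rw [LieRing.of_associative_ring_bracket, Algebra.commutes, sub_self]
  rw [ha, map_zero, add_zero, LieHom.map_lie]
  simp only [lie_add, add_lie, h1, h2, add_zero]

end TwistedLieHom

/-! ### Pointwise calculus: smoothness and the Leibniz rule -/

section Pointwise

variable {A : Type*} [NormedCommRing A] [NormedAlgebra ℝ A] [NormedAlgebra ℚ A] [CompleteSpace A]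
  [StarRing A] {N : Type*} [Fintype N] [DecidableEq N] {H : RealMatrixGroup A N}
  {G : Type*} [Group G] (ι : H.carrier →* G) {c : G →* ℂˣ} {δ : H.lie →ₗ[ℝ] ℂ}

/-- `(c · φ)(g · ι (exp X)) = c(g) e^{δ(X)} φ (g · ι (exp X))`. [folklore] -/
theorem mulChar_apply_mul_expMem_of_exp
    (hc : ∀ X : H.lie, (c (ι (H.expMem X)) : ℂ) = Complex.exp (δ X)) (φ : G → ℂ) (g : G)
    (X : H.lie) :
    mulChar c φ (g * ι (H.expMem X)) =
      (c g : ℂ) * Complex.exp (δ X) * φ (g * ι (H.expMem X)) := by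
  rw [mulChar_apply, map_mul, Units.val_mul, hc]

open scoped Matrix.Norms.Operator in
/-- **Multiplication by a character with a differential preserves smoothness** in the archimedean
variable (`X ↦ e^{δ(X)}` is smooth on `𝔤`). Borel–Jacquet 1979, §4.2 (b). [cite: BorelJacquet1979, §4.2] -/
theorem isArchSmooth_mulChar_of_exp [FiniteDimensional ℝ A]
    (hc : ∀ X : H.lie, (c (ι (H.expMem X)) : ℂ) = Complex.exp (δ X)) {φ : G → ℂ}
    (hφ : IsArchSmooth ι φ) : IsArchSmooth ι (mulChar c φ) := by
  intro g
  let δ' : H.lie.toSubmodule →ₗ[ℝ] ℂ :=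
    { toFun := fun X => δ ⟨X, X.2⟩
      map_add' := fun X Y => by rw [← map_add]; rfl
      map_smul' := fun r X => by rw [RingHom.id_apply, ← map_smul]; rfl }
  have hδ : ContDiff ℝ ∞ fun X : H.lie.toSubmodule => Complex.exp (δ ⟨X, X.2⟩) :=
    Complex.contDiff_exp.comp (LinearMap.toContinuousLinearMap δ').contDiff
  have hfun : (fun X : H.lie.toSubmodule ↦ mulChar c φ (g * ι (H.expMem ⟨X, X.2⟩))) =
      fun X : H.lie.toSubmodule ↦
        (c g : ℂ) * Complex.exp (δ ⟨X, X.2⟩) * φ (g * ι (H.expMem ⟨X, X.2⟩)) := by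
    funext X
    exact mulChar_apply_mul_expMem_of_exp ι hc φ g _
  rw [hfun]
  exact (contDiff_const.mul hδ).mul (hφ g)

/-- `exp (0 : 𝔤) = 1` in `H`. [folklore] -/
theorem RealMatrixGroup.expMem_zero' (H : RealMatrixGroup A N) : H.expMem (0 : H.lie) = 1 :=
  Subtype.ext (by simp)

/-- **Leibniz rule for the Lie derivative of `c · φ`**: `X (c · φ) = c · (X φ + δ(X) φ)` for
`φ` smooth in the archimedean variable and `c (ι (exp tX)) = e^{t δ(X)}`.
Borel–Jacquet 1979, §1.5 and §4.2. [cite: BorelJacquet1979, §1.5] -/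
theorem lieDeriv_mulChar_of_exp [FiniteDimensional ℝ A]
    (hc : ∀ X : H.lie, (c (ι (H.expMem X)) : ℂ) = Complex.exp (δ X)) (X : H.lie) {φ : G → ℂ}
    (hφ : IsArchSmooth ι φ) :
    lieDeriv ι X (mulChar c φ) = mulChar c (lieDeriv ι X φ + δ X • φ) := by
  funext g
  have h1 : HasDerivAt (fun t : ℝ => Complex.exp (δ (t • X))) (δ X) 0 := by
    have hlin : HasDerivAt (fun t : ℝ => δ (t • X)) (δ X) 0 := by
      have hf : (fun t : ℝ => δ (t • X)) = fun t : ℝ => (t : ℂ) * δ X := by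
        funext t
        rw [map_smul, Complex.real_smul]
      rw [hf]
      simpa using (Complex.ofRealCLM.hasDerivAt (x := (0 : ℝ))).mul_const (δ X)
    simpa using hlin.cexp
  have h2 : HasDerivAt (fun t : ℝ => φ (g * ι (H.expMem (t • X)))) (lieDeriv ι X φ g) 0 :=
    hφ.hasDerivAt_flow_zero ι X g
  have h12 : HasDerivAt (fun t : ℝ => mulChar c φ (g * ι (H.expMem (t • X))))
      ((c g : ℂ) * (δ X * φ (g * ι (H.expMem ((0 : ℝ) • X))) +
        Complex.exp (δ ((0 : ℝ) • X)) * lieDeriv ι X φ g)) 0 := by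
    refine ((h1.mul h2).const_mul (c g : ℂ)).congr_of_eventuallyEq
      (Filter.Eventually.of_forall fun t => ?_)
    simp only [Pi.mul_apply, mulChar_apply_mul_expMem_of_exp ι hc, mul_assoc]
  rw [lieDeriv, h12.deriv]
  simp only [zero_smul, map_zero, Complex.exp_zero, RealMatrixGroup.expMem_zero', map_one,
    mul_one, one_mul, mulChar_apply, Pi.add_apply, Pi.smul_apply, smul_eq_mul]
  ring

end Pointwise

/-! ### The word action on smooth functions is multiplicative -/

section Words

variable {A : Type*} [NormedCommRing A] [NormedAlgebra ℝ A] [NormedAlgebra ℚ A] [CompleteSpace A]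
  [StarRing A] {N : Type*} [Fintype N] [DecidableEq N] {H : RealMatrixGroup A N}
  {G : Type*} [Group G] (ι : H.carrier →* G)

/-- The letter `X` acts by the Lie derivative: `(ι X) φ = X φ`. Borel–Jacquet 1979, §1.5. [cite: BorelJacquet1979, §1.5] -/
theorem applyFree_ι_eq_lieDeriv (X : H.lie) (φ : G → ℂ) :
    applyFree ι (FreeAlgebra.ι ℝ X) φ = lieDeriv ι X φ := by
  rw [← one_mul (FreeAlgebra.ι ℝ X), applyFree_mul_ι, applyFree_one]

/-- Scalars act by scalars: `(r · 1) φ = r φ`. Borel–Jacquet 1979, §1.6. [cite: BorelJacquet1979, §1.6] -/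
theorem applyFree_algebraMap (r : ℝ) (φ : G → ℂ) :
    applyFree ι (algebraMap ℝ (FreeAlgebra ℝ H.lie) r) φ = (r : ℂ) • φ := by
  rw [Algebra.algebraMap_eq_smul_one, applyFree_smul_left, applyFree_one]

/-- **`(p q) φ = p (q φ)` on smooth functions** (every linear real group `H`, finite-dimensional
coefficients): the word action factors through the algebra homomorphism
`U(𝔤) → End_ℂ (smooth functions)` (`coe_envelopingAction_freeToEnveloping_of_forall_eq`).
Borel–Jacquet 1979, §1.5–1.6. [cite: BorelJacquet1979, §1.6] -/
theorem applyFree_mul_apply_of_isArchSmooth [FiniteDimensional ℝ A] (p q : FreeAlgebra ℝ H.lie)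
    {φ : G → ℂ} (hφ : IsArchSmooth ι φ) :
    applyFree ι (p * q) φ = applyFree ι p (applyFree ι q φ) := by
  obtain ⟨ρ, hρ⟩ := exists_lieHom_lieDeriv ι
  have hq : IsArchSmooth ι (applyFree ι q φ) := isArchSmooth_applyFree_of_isArchSmooth q hφ
  have e : envelopingAction ρ (freeToEnveloping H q) ⟨φ, hφ⟩ = ⟨applyFree ι q φ, hq⟩ :=
    Subtype.ext (coe_envelopingAction_freeToEnveloping_of_forall_eq ρ hρ q ⟨φ, hφ⟩)
  rw [← coe_envelopingAction_freeToEnveloping_of_forall_eq ρ hρ _ ⟨φ, hφ⟩, map_mul, map_mul,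
    Module.End.mul_apply, e, coe_envelopingAction_freeToEnveloping_of_forall_eq ρ hρ p]

end Words

/-! ### The word action on `c · φ`: conjugation into the twisted action of `U(𝔤)` -/

section Conjugation

variable {A : Type*} [NormedCommRing A] [NormedAlgebra ℝ A] [NormedAlgebra ℚ A] [CompleteSpace A]
  [StarRing A] {N : Type*} [Fintype N] [DecidableEq N] {H : RealMatrixGroup A N}
  {G : Type*} [Group G] (ι : H.carrier →* G) {c : G →* ℂˣ} {δ : H.lie →ₗ[ℝ] ℂ}

/-- **`p (c · φ) = c · (τ_δ p) φ`.** Let `ρ : 𝔤 → End_ℂ (smooth functions)` act by Lie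
derivatives (`exists_lieHom_lieDeriv`) and let `ρ'(X) = ρ(X) + δ(X) · 1` be its twist by the
differential `δ` of `c` along `exp 𝔤` (`exists_lieHom_add_smul_one`; so `δ` kills brackets). Then
for every `p ∈ ℝ⟨𝔤⟩` and smooth `φ`, the word action of `p` on `c · φ` is `c` times the action of
the image of `p` in `U(𝔤)` through `ρ'` on `φ` — by induction on `p`, the letters being the
Leibniz rule `lieDeriv_mulChar_of_exp` and products `applyFree_mul_apply_of_isArchSmooth`.
Borel–Jacquet 1979, §1.5–1.6 and §4.2; Dixmier 2.2. [cite: BorelJacquet1979, §1.6] -/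
theorem applyFree_mulChar_eq_envelopingAction [FiniteDimensional ℝ A]
    (hc : ∀ X : H.lie, (c (ι (H.expMem X)) : ℂ) = Complex.exp (δ X))
    {ρ : H.lie →ₗ⁅ℝ⁆ Module.End ℂ (archSmooth ι)}
    (hρ : ∀ (X : H.lie) (ψ : archSmooth ι), ((ρ X ψ : archSmooth ι) : G → ℂ) = lieDeriv ι X ψ)
    {ρ' : H.lie →ₗ⁅ℝ⁆ Module.End ℂ (archSmooth ι)}
    (hρ' : ∀ X, ρ' X = ρ X + δ X • (1 : Module.End ℂ (archSmooth ι)))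
    (p : FreeAlgebra ℝ H.lie) {φ : G → ℂ} (hφ : IsArchSmooth ι φ) :
    applyFree ι p (mulChar c φ) =
      mulChar c ((envelopingAction ρ' (freeToEnveloping H p) ⟨φ, hφ⟩ : archSmooth ι) : G → ℂ) := by
  induction p using FreeAlgebra.induction generalizing φ with
  | grade0 r =>
    rw [AlgHom.commutes, AlgHom.commutes, applyFree_algebraMap, Module.algebraMap_end_apply,
      Submodule.coe_smul_of_tower, real_smul_fun_eq_coe_smul, map_smul]
  | grade1 X =>
    rw [freeToEnveloping_ι, envelopingAction_ι, hρ', LinearMap.add_apply, LinearMap.smul_apply,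
      Module.End.one_apply, Submodule.coe_add, Submodule.coe_smul, hρ, applyFree_ι_eq_lieDeriv,
      lieDeriv_mulChar_of_exp ι hc X hφ]
  | add p q hp hq =>
    rw [applyFree_add, map_add, map_add, LinearMap.add_apply, Submodule.coe_add, map_add, hp hφ,
      hq hφ]
  | mul p q hp hq =>
    rw [applyFree_mul_apply_of_isArchSmooth ι p q (isArchSmooth_mulChar_of_exp ι hc hφ), hq hφ,
      hp ((mem_archSmooth_iff ι _).1 (Subtype.coe_prop _)), map_mul, map_mul, Module.End.mul_apply]

end Conjugation

/-! ### Real differentials: the substitution `X ↦ X + λ(X)` and the centre of `U(𝔤)` -/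

section Real

variable {A : Type*} [NormedCommRing A] [NormedAlgebra ℝ A] [NormedAlgebra ℚ A] [CompleteSpace A]
  [StarRing A] {N : Type*} [Fintype N] [DecidableEq N] {H : RealMatrixGroup A N}
  {G : Type*} [Group G] (ι : H.carrier →* G) {c : G →* ℂˣ} {lam : H.lie →ₗ[ℝ] ℝ}

variable (H) in
/-- **The substitution `X ↦ X + λ(X)` descends to an automorphism of `U(𝔤)` preserving the
centre**, for `λ : 𝔤 → ℝ` linear and vanishing on brackets: the image in `U(𝔤)` of the
substituted polynomial `FreeAlgebra.lift (X ↦ ι X + λ(X))(p)` is `τ(\bar p)` for the algebra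
endomorphism `τ` of `U(𝔤)` lifting the Lie homomorphism `X ↦ ι X + λ(X)`
(`exists_lieHom_add_algebraMap`), whose inverse is the lift of `X ↦ ι X - λ(X)`; an automorphism
maps the centre onto the centre. Hence the substitution maps central words to central words.
Dixmier, *Enveloping Algebras*, 2.2 (functoriality of `U`) and 2.1.1. [folklore] -/
theorem isCentralWord_lift_add_algebraMap (hlam : ∀ X Y : H.lie, lam ⁅X, Y⁆ = 0)
    {p : FreeAlgebra ℝ H.lie} (hp : IsCentralWord p) :
    IsCentralWord (FreeAlgebra.lift ℝ
      (fun X => FreeAlgebra.ι ℝ X + algebraMap ℝ (FreeAlgebra ℝ H.lie) (lam X)) p) := by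
  -- the Lie homomorphisms `X ↦ ι X ± λ(X)` into `U(𝔤)` and their lifts `τ, τ'`
  obtain ⟨f, hf⟩ := exists_lieHom_add_algebraMap (UniversalEnvelopingAlgebra.ι ℝ (L := H.lie)) lam hlam
  obtain ⟨f', hf'⟩ := exists_lieHom_add_algebraMap (UniversalEnvelopingAlgebra.ι ℝ (L := H.lie))
    (-lam) (fun X Y => by rw [LinearMap.neg_apply, hlam, neg_zero])
  set τ := UniversalEnvelopingAlgebra.lift ℝ f with hτ
  set τ' := UniversalEnvelopingAlgebra.lift ℝ f' with hτ'
  -- `τ ∘ τ' = id`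
  have hττ' : τ.comp τ' = AlgHom.id ℝ _ := by
    refine UniversalEnvelopingAlgebra.hom_ext (h := LieHom.ext fun X => ?_)
    change τ (τ' (UniversalEnvelopingAlgebra.ι ℝ X)) = UniversalEnvelopingAlgebra.ι ℝ X
    rw [hτ', UniversalEnvelopingAlgebra.lift_ι_apply, hf', map_add, AlgHom.commutes, hτ,
      UniversalEnvelopingAlgebra.lift_ι_apply, hf, LinearMap.neg_apply, map_neg,
      add_neg_cancel_right]
  -- the substitution on the free algebra lifts `τ`
  have hsub : (freeToEnveloping H).comp (FreeAlgebra.lift ℝ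
      (fun X => FreeAlgebra.ι ℝ X + algebraMap ℝ (FreeAlgebra ℝ H.lie) (lam X))) =
      τ.comp (freeToEnveloping H) := by
    refine FreeAlgebra.hom_ext (funext fun X => ?_)
    simp only [Function.comp_apply, AlgHom.comp_apply, FreeAlgebra.lift_ι_apply, map_add,
      AlgHom.commutes, freeToEnveloping_ι]
    rw [hτ, UniversalEnvelopingAlgebra.lift_ι_apply, hf]
  have key : freeToEnveloping H (FreeAlgebra.lift ℝ
      (fun X => FreeAlgebra.ι ℝ X + algebraMap ℝ (FreeAlgebra ℝ H.lie) (lam X)) p) =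
      τ (freeToEnveloping H p) := by
    have := congrArg (fun F => F p) hsub
    simpa only [AlgHom.comp_apply] using this
  -- an endomorphism with a right inverse maps the centre into the centre
  unfold IsCentralWord at hp ⊢
  rw [key, Subalgebra.mem_center_iff]
  intro u
  have hu : u = τ (τ' u) := by
    change u = (τ.comp τ') u
    rw [hττ', AlgHom.id_apply]
  rw [hu, ← map_mul, ← map_mul, (Subalgebra.mem_center_iff.1 hp) (τ' u)]

/-- **The twisted action is the action of the substituted polynomial**: if
`ρ'(X) = ρ(X) + λ(X) · 1` with `λ : 𝔤 → ℝ`, then the action of `\bar p ∈ U(𝔤)` through `ρ'` is the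
action of the image of the substituted polynomial `FreeAlgebra.lift (X ↦ ι X + λ(X))(p)` through
`ρ` (two algebra homomorphisms `ℝ⟨𝔤⟩ → End` agreeing on letters). Dixmier 2.2. [folklore] -/
theorem envelopingAction_freeToEnveloping_eq_of_add {V : Type*} [AddCommGroup V] [Module ℂ V]
    {ρ ρ' : H.lie →ₗ⁅ℝ⁆ Module.End ℂ V}
    (hρ' : ∀ X, ρ' X = ρ X + ((lam X : ℝ) : ℂ) • (1 : Module.End ℂ V)) (p : FreeAlgebra ℝ H.lie) :
    envelopingAction ρ' (freeToEnveloping H p) = envelopingAction ρ (freeToEnveloping H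
      (FreeAlgebra.lift ℝ (fun X => FreeAlgebra.ι ℝ X + algebraMap ℝ (FreeAlgebra ℝ H.lie) (lam X)) p)) := by
  have hhom : (envelopingAction ρ').comp (freeToEnveloping H) =
      (envelopingAction ρ).comp ((freeToEnveloping H).comp (FreeAlgebra.lift ℝ
        (fun X => FreeAlgebra.ι ℝ X + algebraMap ℝ (FreeAlgebra ℝ H.lie) (lam X)))) := by
    refine FreeAlgebra.hom_ext (funext fun X => ?_)
    simp only [Function.comp_apply, AlgHom.comp_apply, freeToEnveloping_ι, envelopingAction_ι,
      hρ', FreeAlgebra.lift_ι_apply, map_add, AlgHom.commutes]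
    rw [Algebra.algebraMap_eq_smul_one, ← algebraMap_smul ℂ (lam X) (1 : Module.End ℂ V)]
    rfl
  have := congrArg (fun F => F p) hhom
  simpa only [AlgHom.comp_apply] using this

/-- **Real differentials: `p (c · φ) = c · (p' φ)` with `p'` central if `p` is.** If
`c (ι (exp X)) = e^{λ(X)}` with `λ : 𝔤 → ℝ` linear and vanishing on brackets, then for every
central word `p ∈ ℝ⟨𝔤⟩` there is a central word `p'` (the substitution `X ↦ X + λ(X)` applied to
`p`) with `p (c · φ) = c · (p' φ)` for all smooth `φ`. Borel–Jacquet 1979, §1.6 and §4.2 (c);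
Dixmier 2.2. [cite: BorelJacquet1979, §4.2] -/
theorem exists_isCentralWord_applyFree_mulChar_eq [FiniteDimensional ℝ A]
    (hlam : ∀ X Y : H.lie, lam ⁅X, Y⁆ = 0)
    (hc : ∀ X : H.lie, (c (ι (H.expMem X)) : ℂ) = Complex.exp ((lam X : ℝ) : ℂ))
    {p : FreeAlgebra ℝ H.lie} (hp : IsCentralWord p) :
    ∃ p' : FreeAlgebra ℝ H.lie, IsCentralWord p' ∧
      ∀ {φ : G → ℂ} (hφ : IsArchSmooth ι φ), applyFree ι p (mulChar c φ) = mulChar c (applyFree ι p' φ) := by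
  set σ := FreeAlgebra.lift ℝ
    (fun X => FreeAlgebra.ι ℝ X + algebraMap ℝ (FreeAlgebra ℝ H.lie) (lam X)) with hσ
  refine ⟨σ p, isCentralWord_lift_add_algebraMap H hlam hp, fun {φ} hφ => ?_⟩
  obtain ⟨ρ, hρ⟩ := exists_lieHom_lieDeriv ι
  -- the differential `δ = λ` as a complex-valued linear map, and the twisted action
  set δ : H.lie →ₗ[ℝ] ℂ := Complex.ofRealAm.toLinearMap.comp lam with hδ
  have hδ' : ∀ X, δ X = ((lam X : ℝ) : ℂ) := fun X => rfl
  obtain ⟨ρ', hρ'⟩ := exists_lieHom_add_smul_one ρ δ (fun X Y => by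
    rw [hδ', hlam, Complex.ofReal_zero])
  have hc' : ∀ X : H.lie, (c (ι (H.expMem X)) : ℂ) = Complex.exp (δ X) := fun X => by
    rw [hδ', hc]
  rw [applyFree_mulChar_eq_envelopingAction ι hc' hρ hρ' p hφ,
    envelopingAction_freeToEnveloping_eq_of_add (ρ := ρ) (fun X => by rw [hρ', hδ']) p, ← hσ,
    coe_envelopingAction_freeToEnveloping_of_forall_eq ρ hρ]

/-- **`Z(𝔤)`-finiteness is preserved by twisting with a character with real differential**:
if `c (ι (exp X)) = e^{λ(X)}` (`λ : 𝔤 → ℝ` linear, vanishing on brackets) and `φ` is smooth and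
`Z(𝔤)`-finite, so is `c · φ` (its `Z(𝔤)`-orbit span lies in `c ·` that of `φ`).
Borel–Jacquet 1979, §4.2 (c) for `π ⊗ |det|^σ`, `σ ∈ ℝ`. [cite: BorelJacquet1979, §4.2] -/
theorem isZFinite_mulChar_of_exp_real [FiniteDimensional ℝ A]
    (hlam : ∀ X Y : H.lie, lam ⁅X, Y⁆ = 0)
    (hc : ∀ X : H.lie, (c (ι (H.expMem X)) : ℂ) = Complex.exp ((lam X : ℝ) : ℂ))
    {φ : G → ℂ} (hφ : IsArchSmooth ι φ) (hZ : IsZFinite ι φ) : IsZFinite ι (mulChar c φ) := by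
  unfold IsZFinite at hZ ⊢
  refine Submodule.finiteDimensional_of_le (S₂ := (zOrbitSpan ι φ).map (mulChar c)) ?_
  rw [zOrbitSpan, Submodule.span_le]
  rintro _ ⟨p, hp, rfl⟩
  obtain ⟨p', hp', h⟩ := exists_isCentralWord_applyFree_mulChar_eq ι hlam hc hp
  rw [h hφ]
  exact Submodule.mem_map_of_mem (Submodule.subset_span ⟨p', hp', rfl⟩)

end Real

/-! ### Polynomial dependence on a complex parameter and a Vandermonde argument -/

section PolynomialFamily

/-- **The twisted action of a fixed element of `U(𝔤)` is polynomial in the twisting parameter.**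
For a family of Lie algebra homomorphisms `ρ_s(X) = ρ(X) + s λ(X) · 1` (`s ∈ ℂ`), the action of
any `u ∈ U(𝔤)` through `ρ_s` is `P_u(s)` for a polynomial `P_u` with coefficients in `End_ℂ V`
(`U(𝔤)` is generated by `𝔤`, on which the dependence is affine). Dixmier 2.1–2.2. [folklore] -/
theorem exists_polynomial_envelopingAction_eq {A : Type*} [NormedCommRing A] [NormedAlgebra ℝ A]
    [NormedAlgebra ℚ A] [CompleteSpace A] [StarRing A] {N : Type*} [Fintype N] [DecidableEq N]
    {H : RealMatrixGroup A N} {V : Type*} [AddCommGroup V] [Module ℂ V]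
    (ρ : H.lie →ₗ⁅ℝ⁆ Module.End ℂ V) (lam : H.lie →ₗ[ℝ] ℝ)
    (ρs : ℂ → (H.lie →ₗ⁅ℝ⁆ Module.End ℂ V))
    (hρs : ∀ (s : ℂ) (X : H.lie), ρs s X = ρ X + (s * (lam X : ℂ)) • (1 : Module.End ℂ V))
    (u : UniversalEnvelopingAlgebra ℝ H.lie) :
    ∃ P : Polynomial (Module.End ℂ V), ∀ s : ℂ,
      envelopingAction (ρs s) u = P.eval₂ (RingHom.id _) (algebraMap ℂ (Module.End ℂ V) s) := by
  obtain ⟨t, rfl⟩ : ∃ t, UniversalEnvelopingAlgebra.mkAlgHom ℝ H.lie t = u :=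
    RingCon.mkₐ_surjective _ u
  induction t using TensorAlgebra.induction with
  | algebraMap r =>
    refine ⟨Polynomial.C (algebraMap ℝ (Module.End ℂ V) r), fun s => ?_⟩
    rw [AlgHom.commutes, AlgHom.commutes, Polynomial.eval₂_C, RingHom.id_apply]
  | ι X =>
    refine ⟨Polynomial.C (ρ X) + Polynomial.C ((lam X : ℂ) • (1 : Module.End ℂ V)) * Polynomial.X,
      fun s => ?_⟩
    rw [← UniversalEnvelopingAlgebra.ι_apply, envelopingAction_ι, hρs, Polynomial.eval₂_add,
      Polynomial.eval₂_C, Polynomial.eval₂_mul_X, Polynomial.eval₂_C, RingHom.id_apply,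
      RingHom.id_apply, Algebra.algebraMap_eq_smul_one, smul_mul_smul_comm, one_mul, mul_comm]
  | mul a b ha hb =>
    obtain ⟨Pa, hPa⟩ := ha
    obtain ⟨Pb, hPb⟩ := hb
    refine ⟨Pa * Pb, fun s => ?_⟩
    rw [map_mul, map_mul, hPa, hPb, Polynomial.eval₂_mul_noncomm]
    exact fun k => Algebra.commute_algebraMap_right _ _
  | add a b ha hb =>
    obtain ⟨Pa, hPa⟩ := ha
    obtain ⟨Pb, hPb⟩ := hb
    exact ⟨Pa + Pb, fun s => by rw [map_add, map_add, hPa, hPb, Polynomial.eval₂_add]⟩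

/-- **A vector-valued polynomial with values in a subspace at all real points has its coefficients
in the subspace** (Vandermonde / Lagrange interpolation, through the quotient and linear
functionals: a complex polynomial vanishing on `ℝ` is zero). [folklore] -/
theorem mem_of_forall_sum_ofReal_pow_smul_mem {M : Type*} [AddCommGroup M] [Module ℂ M]
    (V : Submodule ℂ M) (v : ℕ → M) (m : ℕ)
    (h : ∀ r : ℝ, ∑ k ∈ Finset.range (m + 1), ((r : ℂ) ^ k) • v k ∈ V) :
    ∀ k ∈ Finset.range (m + 1), v k ∈ V := by
  intro k hk
  rw [← Submodule.Quotient.mk_eq_zero, ← Module.forall_dual_apply_eq_zero_iff ℂ]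
  intro ℓ
  set F : ℂ[X] := ∑ j ∈ Finset.range (m + 1),
    Polynomial.C (ℓ (Submodule.Quotient.mk (v j))) * Polynomial.X ^ j with hF
  have hroot : ∀ r : ℝ, F.IsRoot (r : ℂ) := by
    intro r
    have h0 : (ℓ.comp V.mkQ) (∑ k ∈ Finset.range (m + 1), ((r : ℂ) ^ k) • v k) = 0 := by
      rw [LinearMap.comp_apply, Submodule.mkQ_apply, (Submodule.Quotient.mk_eq_zero V).2 (h r),
        map_zero]
    rw [map_sum] at h0
    rw [Polynomial.IsRoot.def, hF, Polynomial.eval_finsetSum, ← h0]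
    refine Finset.sum_congr rfl fun j _ => ?_
    rw [Polynomial.eval_mul, Polynomial.eval_C, Polynomial.eval_pow, Polynomial.eval_X, map_smul,
      LinearMap.comp_apply, Submodule.mkQ_apply, smul_eq_mul, mul_comm]
  have hF0 : F = 0 := by
    refine Polynomial.eq_zero_of_infinite_isRoot F ?_
    refine Set.Infinite.mono ?_ (Set.infinite_range_of_injective Complex.ofReal_injective)
    rintro _ ⟨r, rfl⟩
    exact hroot r
  have hcoeff : F.coeff k = ℓ (Submodule.Quotient.mk (v k)) := by
    rw [hF, Polynomial.finsetSum_coeff]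
    simp only [Polynomial.coeff_C_mul_X_pow]
    rw [Finset.sum_ite_eq, if_pos hk]
  rw [← hcoeff, hF0, Polynomial.coeff_zero]

end PolynomialFamily

/-! ### Complex multiples of a real differential: `|det|^s`, `s ∈ ℂ` -/

section ComplexFamily

variable {A : Type*} [NormedCommRing A] [NormedAlgebra ℝ A] [NormedAlgebra ℚ A] [CompleteSpace A]
  [StarRing A] {N : Type*} [Fintype N] [DecidableEq N] {H : RealMatrixGroup A N}
  {G : Type*} [Group G] (ι : H.carrier →* G) {c : ℂ → (G →* ℂˣ)} {lam : H.lie →ₗ[ℝ] ℝ}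

/-- **The `Z(𝔤)`-orbit span of `c_s · φ` lies in `c_s ·` (that of `φ`), for a family of characters
`c_s` with `c_s (ι (exp X)) = e^{s λ(X)}`** (`λ : 𝔤 → ℝ` linear, vanishing on brackets; `s ∈ ℂ`
arbitrary; e.g. `c_s = |det|_𝔸^s` on `GL_n(𝔸_K)`). For a central word `p`, `p (c_s · φ) = c_s ·
P(s) φ` with `P` an operator-valued polynomial (`applyFree_mulChar_eq_envelopingAction`,
`exists_polynomial_envelopingAction_eq`); for real `s` the value `P(s) φ` is `p_s φ` for a central
word `p_s` (`envelopingAction_freeToEnveloping_eq_of_add`, `isCentralWord_lift_add_algebraMap`),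
so it lies in the `Z(𝔤)`-orbit span of `φ`; hence so do the coefficients of `P(·) φ`
(`mem_of_forall_sum_ofReal_pow_smul_mem`) and its value at `s`.
Borel–Jacquet 1979, §4.2 (c) and 5.7 (`π ⊗ |det|^s`). [cite: BorelJacquet1979, §4.2] -/
theorem zOrbitSpan_mulChar_le_of_exp_family [FiniteDimensional ℝ A]
    (hlam : ∀ X Y : H.lie, lam ⁅X, Y⁆ = 0)
    (hc : ∀ (s : ℂ) (X : H.lie), (c s (ι (H.expMem X)) : ℂ) = Complex.exp (s * (lam X : ℂ)))
    (s : ℂ) {φ : G → ℂ} (hφ : IsArchSmooth ι φ) :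
    zOrbitSpan ι (mulChar (c s) φ) ≤ (zOrbitSpan ι φ).map (mulChar (c s)) := by
  rw [zOrbitSpan, Submodule.span_le]
  rintro _ ⟨p, hp, rfl⟩
  obtain ⟨ρ, hρ⟩ := exists_lieHom_lieDeriv ι
  -- the family of twisted actions `ρ_z (X) = ρ X + z λ(X)`
  have hex : ∀ z : ℂ, ∃ ρ' : H.lie →ₗ⁅ℝ⁆ Module.End ℂ (archSmooth ι),
      ∀ X, ρ' X = ρ X + (z * (lam X : ℂ)) • (1 : Module.End ℂ (archSmooth ι)) := fun z => by
    obtain ⟨ρ', h⟩ := exists_lieHom_add_smul_one ρ (z • (Complex.ofRealAm.toLinearMap.comp lam))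
      (fun X Y => by
        rw [LinearMap.smul_apply, LinearMap.comp_apply, hlam]
        simp)
    exact ⟨ρ', fun X => by rw [h]; rfl⟩
  choose ρs hρs using hex
  -- `p (c_s φ) = c_s • (ρ_s-action of p on φ)`
  have hcs : ∀ X : H.lie, (c s (ι (H.expMem X)) : ℂ) =
      Complex.exp ((s • (Complex.ofRealAm.toLinearMap.comp lam)) X) := fun X => by
    rw [hc]; rfl
  rw [SetLike.mem_coe, applyFree_mulChar_eq_envelopingAction ι hcs hρ (ρ' := ρs s)
    (fun X => by rw [hρs]; rfl) p hφ]
  refine Submodule.mem_map_of_mem ?_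
  -- polynomial dependence on the parameter
  obtain ⟨P, hP⟩ := exists_polynomial_envelopingAction_eq ρ lam ρs hρs (freeToEnveloping H p)
  have hexp : ∀ z : ℂ, ((envelopingAction (ρs z) (freeToEnveloping H p) ⟨φ, hφ⟩ : archSmooth ι) :
      G → ℂ) = ∑ k ∈ Finset.range (P.natDegree + 1),
        z ^ k • ((P.coeff k ⟨φ, hφ⟩ : archSmooth ι) : G → ℂ) := by
    intro z
    rw [hP z, Polynomial.eval₂_eq_sum_range, LinearMap.sum_apply, Submodule.coe_sum]
    refine Finset.sum_congr rfl fun k _ => ?_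
    rw [RingHom.id_apply, ← map_pow, Module.End.mul_apply, Module.algebraMap_end_apply, map_smul,
      Submodule.coe_smul]
  -- at real parameters the value lies in the `Z(𝔤)`-orbit span of `φ`
  have hreal : ∀ r : ℝ, ∑ k ∈ Finset.range (P.natDegree + 1),
      ((r : ℂ) ^ k) • ((P.coeff k ⟨φ, hφ⟩ : archSmooth ι) : G → ℂ) ∈ zOrbitSpan ι φ := by
    intro r
    rw [← hexp (r : ℂ)]
    have hρr : ∀ X, ρs (r : ℂ) X = ρ X + (((r • lam) X : ℝ) : ℂ) • (1 : Module.End ℂ (archSmooth ι)) :=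
      fun X => by rw [hρs, LinearMap.smul_apply, smul_eq_mul, Complex.ofReal_mul]
    rw [envelopingAction_freeToEnveloping_eq_of_add (ρ := ρ) hρr p,
      coe_envelopingAction_freeToEnveloping_of_forall_eq ρ hρ]
    refine Submodule.subset_span ⟨_, isCentralWord_lift_add_algebraMap H (lam := r • lam)
      (fun X Y => by rw [LinearMap.smul_apply, hlam, smul_zero]) hp, rfl⟩
  -- Vandermonde: the coefficients, hence the value at `s`, lie in the orbit span
  have hcoeff := mem_of_forall_sum_ofReal_pow_smul_mem (zOrbitSpan ι φ)
    (fun k => ((P.coeff k ⟨φ, hφ⟩ : archSmooth ι) : G → ℂ)) P.natDegree hreal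
  rw [hexp s]
  exact Submodule.sum_mem _ fun k hk => Submodule.smul_mem _ _ (hcoeff k hk)

/-- **`Z(𝔤)`-finiteness is preserved by twisting with `|det|^s`, `s ∈ ℂ`**: for a family of
characters `c_s` with `c_s (ι (exp X)) = e^{s λ(X)}` (`λ : 𝔤 → ℝ` linear, vanishing on brackets),
and `φ` smooth in the archimedean variable and `Z(𝔤)`-finite, `c_s · φ` is `Z(𝔤)`-finite for every
complex `s`. This is condition (c) of Borel–Jacquet 1979, §4.2 for the twist `π ⊗ |det|^s`
(op. cit. 5.7), the normalisation "We may assume `π, π'` unitary" of Arthur–Clozel 1989, Ch. 3,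
proof of Thm. 3.1. [cite: BorelJacquet1979, §4.2] -/
theorem isZFinite_mulChar_of_exp_family [FiniteDimensional ℝ A]
    (hlam : ∀ X Y : H.lie, lam ⁅X, Y⁆ = 0)
    (hc : ∀ (s : ℂ) (X : H.lie), (c s (ι (H.expMem X)) : ℂ) = Complex.exp (s * (lam X : ℂ)))
    (s : ℂ) {φ : G → ℂ} (hφ : IsArchSmooth ι φ) (hZ : IsZFinite ι φ) :
    IsZFinite ι (mulChar (c s) φ) := by
  unfold IsZFinite at hZ ⊢
  exact Submodule.finiteDimensional_of_le (zOrbitSpan_mulChar_le_of_exp_family ι hlam hc s hφ)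

/-- Smoothness in the archimedean variable is preserved by every member of such a family.
Borel–Jacquet 1979, §4.2 (b). [cite: BorelJacquet1979, §4.2] -/
theorem isArchSmooth_mulChar_of_exp_family [FiniteDimensional ℝ A]
    (hc : ∀ (s : ℂ) (X : H.lie), (c s (ι (H.expMem X)) : ℂ) = Complex.exp (s * (lam X : ℂ)))
    (s : ℂ) {φ : G → ℂ} (hφ : IsArchSmooth ι φ) : IsArchSmooth ι (mulChar (c s) φ) :=
  isArchSmooth_mulChar_of_exp ι (δ := s • (Complex.ofRealAm.toLinearMap.comp lam))
    (fun X => by rw [hc]; rfl) hφ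

end ComplexFamily

end Literature.NumberTheory.Automorphic
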